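import Summits.CriticalPhenomena.SAWScalingLimit.Theses.SAWChargeContinuation
import Summits.CriticalPhenomena.SAWScalingLimit.Theorems.AvoidanceLimit.Negative.AvoidanceLimitKillCriteria
import Summits.CriticalPhenomena.SAWScalingLimit.Theorems.SAWChargeContinuationAvoidanceOfLimitSuperdomains

/-!
# `SAWAvoidanceLaw` (route `SAWChargeContinuation`) implies `AvoidanceLimit` (route `SAWLoopFugacityFlow`)

Support file for item `stmt-CriticalPhenomena-11195`
(`Summit.CriticalPhenomena.SAWScalingLimit.Theses.SAWChargeContinuation.SAWAvoidanceLaw`: the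
critical `δℤ²` SAW from `a_δ` to `b_δ` in `D_δ` uses only vertices of the hull subdomain `D'` and
closed edges inside `cl D'` with probability `→ Φ'_A(0)^{5/8}`), relating it to the crux
`AvoidanceLimit` of route `SAWLoopFugacityFlow` (stmt-CriticalPhenomena-10649:
`P_δ(range γ_δ ⊆ cl D') → Φ'_A(0)^{5/8}`), whose refutation lane
(`Theorems/AvoidanceLimit/Negative/*`) thereby applies verbatim to `SAWAvoidanceLaw`:

* `avoidanceLimit_of_sawAvoidanceLaw : SAWAvoidanceLaw → AvoidanceLimit` — the LATTICE-EVENT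
  avoidance law implies the CLOSED-RANGE avoidance law, by a sandwich at fixed mesh:
  `{lattice event for D'} ⊆ {range ⊆ cl D'} ⊆ {lattice event for E}` for every carved super-domain
  `E = D ∖ T ⊇ D'` (`T` closed, off `cl D'`; a polyline inside `cl D'` has its vertices in
  `cl D' ∩ D ⊆ E` and its closed edges in `cl D' ⊆ cl E`), the monotone carved exhaustion
  `exists_monotone_superdomains` and the continuity `Φ'_{A_n}(0) → Φ'_A(0)` of its restriction
  derivatives (`tendsto_restrictionDeriv_superdomains`, both from the `AvoidanceOfLimit` support
  file of this route), and an order-topology squeeze in `ℝ≥0∞`.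

Consequently (contrapositive) any refutation of `AvoidanceLimit` refutes `SAWAvoidanceLaw`, and a
proof of `SAWAvoidanceLaw` closes `AvoidanceLimit`. No new definitions. [folklore]
-/

noncomputable section

open Set Filter Topology MeasureTheory Metric
open UpperHalfPlane (upperHalfPlaneSet)
open Literature.Probability.RandomPlanarGeometry Literature.Probability.LatticeModels
open Summit.CriticalPhenomena.SAWScalingLimit.Theses.SAWChargeContinuation (SAWAvoidanceLaw)
open Summit.CriticalPhenomena.SAWScalingLimit.Theses.SAWLoopFugacityFlow (AvoidanceLimit)
open Summit.CriticalPhenomena.SAWScalingLimit.Theorems.AvoidanceLimit.Negative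
  (curve_mem_rangeSubset isHullSubdomain_of_ball range_curve)
open Summit.CriticalPhenomena.SAWScalingLimit.Theorems.AvoidanceOfLimit
  (exists_monotone_superdomains tendsto_restrictionDeriv_superdomains
    isHullSubdomain_of_carrier_eq_diff subset_of_carrier_eq_diff)
open Summit.CriticalPhenomena.SAWScalingLimit.Theorems.IsingBoundaryRatio.Negative (eventually_ne)
open scoped ENNReal

namespace Summit.CriticalPhenomena.SAWScalingLimit.Theorems.SAWChargeContinuation

variable {Ω : Set ℂ} {δ : ℝ} {u v : Site 2}

/-! ### The sandwich at fixed mesh -/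

/-- Every closed edge of a walk lies on the trace of its polyline. [folklore] -/
theorem segment_subset_range_toCurve {V : Type*} {G : SimpleGraph V} (f : V → ℂ) :
    ∀ {x y : V} (p : G.Walk x y), ∀ d ∈ p.darts,
      segment ℝ (f d.fst) (f d.snd) ⊆ Set.range (p.toCurve f)
  | _, _, SimpleGraph.Walk.nil, d, hd => by simp at hd
  | _, _, SimpleGraph.Walk.cons h p, d, hd => by
    rw [SimpleGraph.Walk.range_toCurve_cons]
    rw [SimpleGraph.Walk.darts_cons, List.mem_cons] at hd
    rcases hd with rfl | hd
    · exact subset_union_left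
    · exact (segment_subset_range_toCurve f p d hd).trans subset_union_right

/-- **Inner half of the sandwich.** A SAW of `Ω_δ` between distinct sites whose darts are closed
edges of `cl Ω'` traces a polyline inside `cl Ω'`. [folklore] -/
theorem curve_mem_rangeSubset_of_darts (Ω' : Set ℂ) (huv : u ≠ v) (γ : SAW.DomainSAW Ω δ u v)
    (h : ∀ e ∈ γ.walk.darts, (meshGraph Ω' δ).Adj e.toProd.1 e.toProd.2 ∧
      e.toProd.1 ∈ meshVertices Ω' δ ∧ e.toProd.2 ∈ meshVertices Ω' δ) :
    γ.curve ∈ CurveClass.rangeSubset (closure Ω') :=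
  curve_mem_rangeSubset γ huv fun d hd => (meshGraph_adj_iff.1 (h d hd).1).2

/-- **Outer half of the sandwich.** If the polyline of a SAW of `Ω_δ` lies in `cl Ω'`, where
`Ω' ⊆ Ω` and `T` is disjoint from `cl Ω'`, then every dart of the walk is a closed edge of
`cl (Ω ∖ T)` between mesh vertices of `Ω ∖ T` (vertices lie on the trace, in `cl Ω' ∩ Ω ⊆ Ω ∖ T`;
closed edges lie on the trace, in `cl Ω' ⊆ cl (Ω ∖ T)`). [folklore] -/
theorem darts_of_curve_mem_rangeSubset {Ω' T : Set ℂ} (hsub : Ω' ⊆ Ω)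
    (hT : Disjoint T (closure Ω')) (γ : SAW.DomainSAW Ω δ u v)
    (h : γ.curve ∈ CurveClass.rangeSubset (closure Ω')) :
    ∀ e ∈ γ.walk.darts, (meshGraph (Ω \ T) δ).Adj e.toProd.1 e.toProd.2 ∧
      e.toProd.1 ∈ meshVertices (Ω \ T) δ ∧ e.toProd.2 ∈ meshVertices (Ω \ T) δ := by
  rw [CurveClass.mem_rangeSubset, range_curve] at h
  have hΩ'E : closure Ω' ⊆ closure (Ω \ T) :=
    closure_mono fun z hz => ⟨hsub hz, fun hzT => Set.disjoint_left.1 hT hzT (subset_closure hz)⟩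
  have hvert : ∀ w ∈ γ.walk.support, w ∈ meshDomain Ω δ → w ∈ meshVertices (Ω \ T) δ := by
    intro w hw hwD
    have h1 : meshPoint δ w ∈ closure Ω' := h (SimpleGraph.Walk.mem_range_toCurve _ _ hw)
    refine ⟨meshDomain_subset_meshVertices Ω δ hwD, fun hwT => ?_⟩
    exact Set.disjoint_left.1 hT hwT h1
  intro e he
  have hadj := discreteDomainGraph_adj_iff.1 e.adj
  refine ⟨meshGraph_adj_iff.2 ⟨(meshGraph_adj_iff.1 hadj.1).1, ?_⟩,
    hvert _ (γ.walk.dart_fst_mem_support_of_mem_darts he) hadj.2.1,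
    hvert _ (γ.walk.dart_snd_mem_support_of_mem_darts he) hadj.2.2⟩
  exact (segment_subset_range_toCurve (meshPoint δ) γ.walk e he).trans (h.trans hΩ'E)

/-- The SAW law of an event is finite (at most `1`). [folklore] -/
theorem law_apply_ne_top (S : Set (SAW.DomainSAW Ω δ u v)) : SAW.law Ω δ u v S ≠ ⊤ := by
  refine ne_top_of_le_ne_top ENNReal.one_ne_top ?_
  calc SAW.law Ω δ u v S ≤ SAW.law Ω δ u v Set.univ := measure_mono (Set.subset_univ _)
    _ = (SAW.weight Ω δ u v Set.univ)⁻¹ * SAW.weight Ω δ u v Set.univ := by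
        rw [SAW.law, Measure.smul_apply, smul_eq_mul]
    _ ≤ 1 := ENNReal.inv_mul_le_one _

/-- A real limit of `(P_δ E).toReal` is an `ℝ≥0∞` limit of `P_δ E`. [folklore] -/
theorem tendsto_law_of_tendsto_toReal {Ω : Set ℂ} {a b : ℝ → Site 2}
    {E : ∀ δ : ℝ, Set (SAW.DomainSAW Ω δ (a δ) (b δ))} {l : Filter ℝ} {x : ℝ}
    (h : Tendsto (fun δ => (SAW.law Ω δ (a δ) (b δ) (E δ)).toReal) l (𝓝 x)) :
    Tendsto (fun δ => SAW.law Ω δ (a δ) (b δ) (E δ)) l (𝓝 (ENNReal.ofReal x)) := by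
  refine (ENNReal.tendsto_ofReal h).congr fun δ => ?_
  exact ENNReal.ofReal_toReal (law_apply_ne_top _)

/-! ### The passage -/

/-- **`SAWAvoidanceLaw → AvoidanceLimit`.** The lattice-event avoidance law of route
`SAWChargeContinuation` implies the closed-range avoidance law (crux `AvoidanceLimit` of route
`SAWLoopFugacityFlow`): at fixed mesh `P_δ(lattice event for D') ≤ P_δ(range ⊆ cl D') ≤
P_δ(lattice event for E_n)` for the monotone carved super-domains `E_n = D ∖ T_n ⊇ D'`
(`exists_monotone_superdomains`); the outer terms tend to `d^{5/8}` and `d_n^{5/8}` with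
`d_n = Φ'_{A_n}(0) → d = Φ'_A(0)` (`tendsto_restrictionDeriv_superdomains`), and the squeeze closes
in the order topology of `ℝ≥0∞`. [folklore] -/
theorem avoidanceLimit_of_sawAvoidanceLaw (hA : SAWAvoidanceLaw) : AvoidanceLimit := by
  intro D D' a b hab hsub h0 h1 hball φ hφ A hAeq Φ d hΦ hd
  subst hAeq
  have hHull : D.IsHullSubdomain D' := isHullSubdomain_of_ball hsub h0 h1 hball
  have hstar : IsStarHull (φ.pullbackHull D') :=
    IsStarHull.pullbackHull JordanDomain.isSimplyConnected_holds hφ hHull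
  obtain ⟨d', hd'0, -, hd'⟩ := IsStarHull.exists_hasRestrictionDeriv_holds hstar hΦ
  have hd0 : 0 < d := by rw [hd.unique hstar hd']; exact hd'0
  -- the monotone carved super-domains and their restriction data
  obtain ⟨E, T, hTcl, hTD', hE, hE0, hE1, hmono, hexh⟩ :=
    exists_monotone_superdomains D D' hsub h0 h1
  have hEn : ∀ n, D.IsHullSubdomain (E n) := fun n =>
    isHullSubdomain_of_carrier_eq_diff h0 h1 (hTcl n) (hTD' n) (hE n) (hE0 n) (hE1 n)
  have hAn : ∀ n, IsStarHull (φ.pullbackHull (E n)) := fun n =>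
    IsStarHull.pullbackHull JordanDomain.isSimplyConnected_holds hφ (hEn n)
  have hΦex : ∀ n, ∃ Ψ : ConformalEquiv (upperHalfPlaneSet \ φ.pullbackHull (E n))
      upperHalfPlaneSet, IsRestrictionMap (φ.pullbackHull (E n)) Ψ := fun n =>
    let ⟨Ψ, hΨ, _⟩ := IsStarHull.existsUnique_isRestrictionMap_holds (hAn n); ⟨Ψ, hΨ⟩
  choose Φn hΦn using hΦex
  have hdex : ∀ n, ∃ e : ℝ, 0 < e ∧ HasRestrictionDeriv (φ.pullbackHull (E n)) (Φn n) e :=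
    fun n =>
    let ⟨e, he0, _, he⟩ := IsStarHull.exists_hasRestrictionDeriv_holds (hAn n) (hΦn n)
    ⟨e, he0, he⟩
  choose dn hdn0 hdn using hdex
  have hlimd : Tendsto dn atTop (𝓝 d) :=
    tendsto_restrictionDeriv_superdomains hφ hHull hTcl hTD' hE hE0 hE1 hmono hexh hΦ hd hΦn hdn
  -- the two lattice avoidance laws given by `SAWAvoidanceLaw`
  have hP' := tendsto_law_of_tendsto_toReal (hA D D' hHull a b hab φ hφ Φ d hΦ hd)
  have hPn := fun n =>
    tendsto_law_of_tendsto_toReal (hA D (E n) (hEn n) a b hab φ hφ (Φn n) (dn n) (hΦn n) (hdn n))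
  -- the sandwich at fixed mesh
  set p : ℝ → ℝ≥0∞ := fun δ => ((SAW.law D.carrier δ (a δ) (b δ)).map (fun γ => γ.curve))
    (CurveClass.rangeSubset (closure D'.carrier)) with hp
  have hmeas : MeasurableSet (CurveClass.rangeSubset (closure D'.carrier) :
      Set (CurveClass ℂ)) :=
    (CurveClass.isClosed_rangeSubset isClosed_closure).measurableSet
  have hp_eq : ∀ δ, p δ = SAW.law D.carrier δ (a δ) (b δ)
      {γ | γ.curve ∈ CurveClass.rangeSubset (closure D'.carrier)} := fun δ =>
    Measure.map_apply (SAW.DomainSAW.measurable_of_top _) hmeas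
  have hlow : ∀ᶠ δ in 𝓝[>] (0 : ℝ), SAW.law D.carrier δ (a δ) (b δ)
      {γ | ∀ e ∈ γ.walk.darts, (meshGraph D'.carrier δ).Adj e.toProd.1 e.toProd.2 ∧
        e.toProd.1 ∈ meshVertices D'.carrier δ ∧ e.toProd.2 ∈ meshVertices D'.carrier δ} ≤
      p δ := by
    filter_upwards [eventually_ne hab] with δ hne
    rw [hp_eq]
    exact measure_mono fun γ hγ => curve_mem_rangeSubset_of_darts D'.carrier hne γ hγ
  have hupp : ∀ n δ, p δ ≤ SAW.law D.carrier δ (a δ) (b δ)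
      {γ | ∀ e ∈ γ.walk.darts, (meshGraph (E n).carrier δ).Adj e.toProd.1 e.toProd.2 ∧
        e.toProd.1 ∈ meshVertices (E n).carrier δ ∧
          e.toProd.2 ∈ meshVertices (E n).carrier δ} := by
    intro n δ
    rw [hp_eq, hE n]
    exact measure_mono fun γ hγ => darts_of_curve_mem_rangeSubset hsub (hTD' n) γ hγ
  -- the squeeze
  have hlimdn : Tendsto (fun n => ENNReal.ofReal (dn n ^ ((5 : ℝ) / 8))) atTop
      (𝓝 (ENNReal.ofReal (d ^ ((5 : ℝ) / 8)))) :=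
    ENNReal.tendsto_ofReal (hlimd.rpow_const (Or.inl hd0.ne'))
  rw [tendsto_order]
  refine ⟨fun x hx => ?_, fun x hx => ?_⟩
  · filter_upwards [hlow, (tendsto_order.1 hP').1 x hx] with δ h1 h2
    exact h2.trans_le h1
  · obtain ⟨n, hn⟩ := ((tendsto_order.1 hlimdn).2 x hx).exists
    filter_upwards [(tendsto_order.1 (hPn n)).2 x hn] with δ h1
    exact (hupp n δ).trans_lt h1

end Summit.CriticalPhenomena.SAWScalingLimit.Theorems.SAWChargeContinuation

end
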